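import Literature.MathematicalPhysics.QuantumFieldTheory.Balaban1983to89.B9Thm37CubeCoverCommutators
import Literature.MathematicalPhysics.QuantumFieldTheory.Balaban1983to89.Node00.OpsYNablaBridge

/-!
# `Balaban1983to89.B9Eq3104CutoffCommutators` — T. Bałaban, *Propagators for lattice gauge theories in a background field*,
# Commun. Math. Phys. **99** (1985) 389–434 [Balaban1985BackgroundPropagators], Sect. C pp. 413–414, **(3.100)–(3.104)**: THE LEIBNIZ LETTERS OF THE
# COVARIANT BOND-SECTOR OPERATORS THROUGH A REAL CUT-OFF `h` — «(D_μ hA_ν)(x) = h(x)(D_μA_ν)(x) + (∂_μh)(x)R(U(x, x+ηe_μ))A_ν(x+ηe_μ), (3.100)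
# similarly for adjoint derivatives, hence the commutators [D*D, h] and [DD*, h] are first order differential operators with coefficients determined
# by derivatives of the function h», «(Q_j hA)(c) = h(c₋)(Q_jA)(c) + (S_j(∂h)A)(c) (3.102)», «(Q*aQhA)(b) = h(b₋)(Q*aQA)(b) − (S*(∂h)aQA)(b) +
# (Q*aS(∂h)A)(b) (3.103)», «Δ_a hA = hΔ_a A − K(h)A − P₁(∂h)A (3.104)» — AT def-Y's COVARIANT LETTERS `Node00.OpsYDeltaA` (`gradY`, `divY`, `curlY`,
# `coCurlY`, `QY`, `QsY`, `jordanY`, `aY`, `RY`, `deltaAY = hessY + gradY∘RY∘divY + QsY∘aY∘QY`) and `Node00.OpsYOfLetters` (`cdB`, `cdsB`)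
# (sub-row G-B9-LETTERS, module M5.7, combinatorial half, file A′ — the bond-sector twin of this seat's `B9Thm37CubeCoverCommutators`)

statement-level skeleton of published theorems with citation tags; proofs where landed; nothing here is a claim about the Yang–Mills mass gap

PDF held: `paper:balaban1985-cmp99-background-propagators` (journal page = PDF page + 388); pp. 413–414 read from the text layer `p0025.txt` ∕ `p0026.txt`
(the displayed formulas (3.100)–(3.105) are legible there; quoted above as printed).  p. 414 continues: «where K(h) is a sum of a first order
differential operator and the last two terms on the right-hand side of (3.103)», «The operator Δ′ is small and local by (3.10), hence the commutator
[Δ′, h] gives the factor O(M⁻¹) too», «DRD* = DD* − DPD*. The operator DD* was considered above, and DPD* has a regular kernel satisfying (3.49), hence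
(DPD*hA)_μ(x) = h(x)(DPD*A)_μ(x) + … = h(x)(DPD*A)_μ(x) + (P₁(∂h)A)_μ(x). (3.101)».

## THE DEVICE (one generic lemma, print's «coefficients determined by derivatives of the function h»)
Every covariant letter of def-Y's bond sector is a TRANSPORTED LIFT `Node00.trLiftY M T : (X → 𝔸) →ₗ[ℂ] (Y → 𝔸)`, `(M♯_TΛ)(y) = Σ_x M(y,x)•R(T(y,x))Λ(x)`,
of a flat nearest-neighbour ∕ averaging kernel `M` between two carriers `X`, `Y` (sites, bonds, plaquettes, blocks, coarse bonds).  For real profiles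
`h_X`, `h_Y` on the two carriers the RECTANGULAR COMMUTATOR `h_Y·(M♯_T) − (M♯_T)·h_X` is again a transported lift, with kernel `M(y,x)(h_Y(y) − h_X(x))`
and the SAME transporters (`cutCommR_trLiftY`) — so (3.100)–(3.103) are instances, and products are handled by the Leibniz rule `cutCommR_comp`.
The profiles on the carriers are the pull-backs of one site profile `h` to base points (print's `h(x)` for the bond `⟨x, x+ηe_μ⟩`; for a coarse bond the corner of
its carrier block `β(c) ∈ 𝔅`, the tree's reading of print's `c₋ ∈ Λ_j`): `hBdY`, `hPlY`, `hBkY`, `hIbY`.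

## WHAT THIS FILE PROVES (kernel-checked, 0 sorry; DEFINITIONS with bodies + THEOREMS; no `def … : Prop`, no new fact)
* §1 generic: `cutCommR hY hX A := cutMulY hY ∘ₗ A − A ∘ₗ cutMulY hX` (+ `_apply`, `comp_cutMulY_eq_sub` = the «h(x)(DA)(x) + …» shape, `_add`, `_sub`,
  `_smul`, `_sum`, `_zero`), ★ `cutCommR_comp` (Leibniz through an intermediate carrier), ★ `cutCommR_trLiftY` (+ `_apply`), `cutCommR_liftMatY`,
  `cutCommR_self_eq_cutCommY` (the square case is `B9Thm37CubeCoverCommutators.cutCommY`); SIZES at bi-contraction transporters: `norm_trLiftY_apply_le`,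
  ★ `norm_cutCommR_trLiftY_apply_le` (`≤ Σ_x |M(y,x)|·|h_Y(y) − h_X(x)|·‖Λ(x)‖`), `norm_cutCommR_trLiftY_apply_le_of_bound` (`≤ θ·B·Σ_x|M(y,x)|`).
* §2 at def-Y's letters: the base-point profiles `hBdY ∕ hPlY ∕ hBkY ∕ hIbY`; the commutators of `gradY`, `divY`, `curlY`, `coCurlY`, `QY`, `QsY`, `QpY`,
  `QpsY` as transported lifts of `kernel ⊙ (h − h)` (one line each); `cutCommR_jordanY = 0`, `cutCommR_aY = 0`, `cutCommR_liftMatY_diagonal = 0`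
  (fibrewise letters commute with cut-offs); ★ (3.102)–(3.103) `cutCommR_QsY_aY_QY` («− S*(∂h)aQ + Q*aS(∂h)», two terms since `[a, h] = 0`).
* §3 (3.100) POINTWISE for the function-style letters `cdB`, `cdsB` of the (3.42)-type readings: `cdB_cutMulY_apply`, `cdsB_cutMulY_apply`.
* §4 ★ `KlocY h parS parB Gp U := cutCommR (hBdY h) (hBdY h) (Δ_loc(U))`, `Δ_loc := hessY + gradY∘divY + QsY∘aY∘QY` (the LOCAL part of `Δ_a`; print's
  `K(h)` up to the `[Δ′, h]` bookkeeping which print also puts in `K`), `P1Y h … := −cutCommR … (gradY∘(1 − RY)∘divY)` (print's `P₁(∂h) = [DPD*, h]`,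
  `P = 1 − R`), `deltaAY_eq_loc_sub` (`Δ_a = Δ_loc − D(1−R)D*`, i.e. «DRD* = DD* − DPD*»), ★★ `deltaAY_comp_cutMulY` — **(3.104)**:
  `Δ_a(U) ∘ (h·) = (h·) ∘ Δ_a(U) − K(h)(U) − P₁(∂h)(U)`, and `KlocY_eq_sum` (K(h) = Hessian part + `[D,h]D* + D[D*,h]` + the two (3.103) terms).
HONEST SCOPE.  Algebra only (the print-shape SIZES O(M⁻¹) ∕ O(M⁻²) of the coefficient kernels are file B′); `Δ′`'s commutator is carried inside `KlocY`
through `hessY = D*𝒦D + Δ′₂` (def-Y's polarisation of (3.10)) without a separate stencil formula; the P-terms of (3.105) and the factors `R_α(X)` of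
(3.107) are NOT here (they need the cube letters `G_□(U)` of p. 409 and print's «It is difficult to make the last statement more precise», p. 413);
nothing of Thm 3.10 ∕ 3.3 asserted; nothing continuum ∕ OS ∕ mass gap ∕ Clay; YM mass gap NOT proved by any of this (Track A conditional rung).
`--supports stmt-QuantumFields-19200`.  Net new unproved facts: 0.
-/

noncomputable section

namespace Literature.MathematicalPhysics.QuantumFieldTheory.Balaban1983to89.B9Eq3104CutoffCommutators

open Node00
open B9Thm37CubeCoverCommutators (cutMulY cutMulY_apply cutCommY)
open B6KLevelCensusIndexV1 (KIdx)
open B6Ineq2142KLevelV1 (β)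
open B9BackgroundsKLevelV1 (shiftsV1)
open B6GlobalChartV1 (PV)
open Node00.OpsYNablaBridge (chartY)
open B9Eq39Adjoint (R R_one R_add R_sub R_smul R_zero R_inv_R)
open scoped Matrix

variable {𝔸 : Type} [NormedRing 𝔸] [NormedAlgebra ℂ 𝔸] [CompleteSpace 𝔸]

/-! ## §1 The rectangular cut-off commutator and its calculus -/

section Generic

variable {X Y Z : Type}

/-- **THE RECTANGULAR CUT-OFF COMMUTATOR** of an operator `A : (X → 𝔸) → (Y → 𝔸)` between two carriers with real profiles `h_X`, `h_Y`:
`[h]A := h_Y·A − A·h_X` (print's `[D, h]`, `S_j(∂h)`, …, with the sign of `K(h) = hΔ_a − Δ_a h` of (3.104)).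
[cite: Balaban1985BackgroundPropagators, (3.100)–(3.104) pp.413–414] -/
def cutCommR (hY : Y → ℝ) (hX : X → ℝ) (A : (X → 𝔸) →ₗ[ℂ] (Y → 𝔸)) : (X → 𝔸) →ₗ[ℂ] (Y → 𝔸) :=
  cutMulY hY ∘ₗ A - A ∘ₗ cutMulY hX

omit [CompleteSpace 𝔸] in
/-- the rectangular commutator, evaluated. [cite: Balaban1985BackgroundPropagators, (3.100) p.413, bookkeeping] -/
theorem cutCommR_apply (hY : Y → ℝ) (hX : X → ℝ) (A : (X → 𝔸) →ₗ[ℂ] (Y → 𝔸)) (Λ : X → 𝔸) (y : Y) :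
    cutCommR hY hX A Λ y = ((hY y : ℝ) : ℂ) • A Λ y - A (cutMulY hX Λ) y := by
  simp only [cutCommR, LinearMap.sub_apply, LinearMap.comp_apply, Pi.sub_apply, cutMulY_apply]

omit [CompleteSpace 𝔸] in
/-- ★ **THE (3.100) SHAPE**: `A(hΛ) = h·(AΛ) − ([h]A)Λ` («(D_μ hA_ν)(x) = h(x)(D_μA_ν)(x) + …»). [cite: Balaban1985BackgroundPropagators, (3.100) p.413, (3.104) p.414] -/
theorem comp_cutMulY_eq_sub (hY : Y → ℝ) (hX : X → ℝ) (A : (X → 𝔸) →ₗ[ℂ] (Y → 𝔸)) :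
    A ∘ₗ cutMulY hX = cutMulY hY ∘ₗ A - cutCommR hY hX A := by
  rw [cutCommR, sub_sub_cancel]

omit [CompleteSpace 𝔸] in
/-- additivity in the operator. [cite: Balaban1985BackgroundPropagators, (3.104) p.414, bookkeeping] -/
theorem cutCommR_add (hY : Y → ℝ) (hX : X → ℝ) (A B : (X → 𝔸) →ₗ[ℂ] (Y → 𝔸)) :
    cutCommR hY hX (A + B) = cutCommR hY hX A + cutCommR hY hX B := by
  simp only [cutCommR, LinearMap.comp_add, LinearMap.add_comp]; abel

omit [CompleteSpace 𝔸] in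
/-- subtractivity in the operator. [cite: Balaban1985BackgroundPropagators, (3.104) p.414, bookkeeping] -/
theorem cutCommR_sub (hY : Y → ℝ) (hX : X → ℝ) (A B : (X → 𝔸) →ₗ[ℂ] (Y → 𝔸)) :
    cutCommR hY hX (A - B) = cutCommR hY hX A - cutCommR hY hX B := by
  simp only [cutCommR, LinearMap.comp_sub, LinearMap.sub_comp]; abel

omit [CompleteSpace 𝔸] in
/-- homogeneity in the operator. [cite: Balaban1985BackgroundPropagators, (3.104) p.414, bookkeeping] -/
theorem cutCommR_smul (hY : Y → ℝ) (hX : X → ℝ) (c : ℂ) (A : (X → 𝔸) →ₗ[ℂ] (Y → 𝔸)) :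
    cutCommR hY hX (c • A) = c • cutCommR hY hX A := by
  simp only [cutCommR, LinearMap.comp_smul, LinearMap.smul_comp, smul_sub]

omit [CompleteSpace 𝔸] in
/-- the commutator of `0` vanishes. [cite: Balaban1985BackgroundPropagators, (3.104) p.414, bookkeeping] -/
theorem cutCommR_zero (hY : Y → ℝ) (hX : X → ℝ) : cutCommR hY hX (0 : (X → 𝔸) →ₗ[ℂ] (Y → 𝔸)) = 0 := by
  simp only [cutCommR, LinearMap.comp_zero, LinearMap.zero_comp, sub_zero]

omit [CompleteSpace 𝔸] in
/-- additivity over finite sums. [cite: Balaban1985BackgroundPropagators, (3.105) p.414, bookkeeping] -/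
theorem cutCommR_sum {κ : Type} (s : Finset κ) (hY : Y → ℝ) (hX : X → ℝ) (A : κ → (X → 𝔸) →ₗ[ℂ] (Y → 𝔸)) :
    cutCommR hY hX (∑ k ∈ s, A k) = ∑ k ∈ s, cutCommR hY hX (A k) := by
  classical
  induction s using Finset.induction_on with
  | empty => simp [cutCommR_zero]
  | insert a s ha ih => rw [Finset.sum_insert ha, Finset.sum_insert ha, cutCommR_add, ih]

omit [CompleteSpace 𝔸] in
/-- ★ **LEIBNIZ THROUGH AN INTERMEDIATE CARRIER**: `[h](A∘B) = ([h]A)∘B + A∘([h]B)` (with the middle profile `h_Y` in both) — how `[D*D, h]`,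
`[DD*, h]`, `[Q*aQ, h]` reduce to the first-order letters. [cite: Balaban1985BackgroundPropagators, p.414 («hence the commutators [D*D, h] and [DD*, h] are first order …»), (3.103)] -/
theorem cutCommR_comp (hZ : Z → ℝ) (hY : Y → ℝ) (hX : X → ℝ) (A : (Y → 𝔸) →ₗ[ℂ] (Z → 𝔸)) (B : (X → 𝔸) →ₗ[ℂ] (Y → 𝔸)) :
    cutCommR hZ hX (A ∘ₗ B) = cutCommR hZ hY A ∘ₗ B + A ∘ₗ cutCommR hY hX B := by
  simp only [cutCommR, LinearMap.sub_comp, LinearMap.comp_sub, LinearMap.comp_assoc]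
  abel

omit [CompleteSpace 𝔸] in
/-- the square case is this seat's `cutCommY` (`K(h)`-shape `h·A − A·h`). [cite: Balaban1985BackgroundPropagators, (3.88) p.409, (3.104) p.414] -/
theorem cutCommR_self_eq_cutCommY (h : X → ℝ) (A : (X → 𝔸) →ₗ[ℂ] (X → 𝔸)) : cutCommR h h A = cutCommY h A := rfl

variable [Fintype X]

omit [CompleteSpace 𝔸] in
/-- ★★ **THE DEVICE — THE COMMUTATOR OF A TRANSPORTED LIFT IS THE TRANSPORTED LIFT OF `M ⊙ (h_Y − h_X)`**: `h_Y·M♯_T − M♯_T·h_X = (M(y,x)(h_Y(y) −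
h_X(x)))♯_T`, same transporters («coefficients determined by derivatives of the function h»). [cite: Balaban1985BackgroundPropagators, (3.100)–(3.102) pp.413–414] -/
theorem cutCommR_trLiftY [Fintype Y] (hY : Y → ℝ) (hX : X → ℝ) (M : Matrix Y X ℝ) (T : Y → X → 𝔸ˣ) :
    cutCommR hY hX (trLiftY M T) = trLiftY (Matrix.of fun y x => M y x * (hY y - hX x)) T := by
  refine LinearMap.ext fun Λ => funext fun y => ?_
  rw [cutCommR_apply, trLiftY_apply, trLiftY_apply, trLiftY_apply, Finset.smul_sum, ← Finset.sum_sub_distrib]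
  refine Finset.sum_congr rfl fun x _ => ?_
  rw [cutMulY_apply, R_smul, smul_smul, smul_smul, ← sub_smul, Matrix.of_apply, ← Complex.ofReal_mul, ← Complex.ofReal_mul,
    ← Complex.ofReal_sub]
  congr 1
  push_cast
  ring

omit [CompleteSpace 𝔸] in
/-- the device, evaluated. [cite: Balaban1985BackgroundPropagators, (3.100) p.413, bookkeeping] -/
theorem cutCommR_trLiftY_apply [Fintype Y] (hY : Y → ℝ) (hX : X → ℝ) (M : Matrix Y X ℝ) (T : Y → X → 𝔸ˣ) (Λ : X → 𝔸) (y : Y) :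
    cutCommR hY hX (trLiftY M T) Λ y = ∑ x, (((M y x * (hY y - hX x) : ℝ)) : ℂ) • R (T y x) (Λ x) := by
  rw [cutCommR_trLiftY, trLiftY_apply]; rfl

omit [CompleteSpace 𝔸] in
/-- the flat case (no transport): `[h](M♯) = (M ⊙ (h_Y − h_X))♯`. [cite: Balaban1985BackgroundPropagators, (3.102) p.414, bookkeeping] -/
theorem cutCommR_liftMatY [Fintype Y] (hY : Y → ℝ) (hX : X → ℝ) (M : Matrix Y X ℝ) :
    cutCommR hY hX (liftMatY 𝔸 M) = liftMatY 𝔸 (Matrix.of fun y x => M y x * (hY y - hX x)) := by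
  refine LinearMap.ext fun Λ => funext fun y => ?_
  rw [cutCommR_apply, liftMatY_apply, liftMatY_apply, liftMatY_apply, Finset.smul_sum, ← Finset.sum_sub_distrib]
  refine Finset.sum_congr rfl fun x _ => ?_
  rw [cutMulY_apply, smul_smul, smul_smul, ← sub_smul, Matrix.of_apply, ← Complex.ofReal_mul, ← Complex.ofReal_mul, ← Complex.ofReal_sub]
  congr 1
  push_cast
  ring

omit [CompleteSpace 𝔸] in
/-- a DIAGONAL flat letter (multiplication by real weights, e.g. `a`) commutes with every cut-off on the same carrier.
[cite: Balaban1985BackgroundPropagators, (3.103) p.414 («Q*aQ» — no `[a, h]` term), bookkeeping] -/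
theorem cutCommR_liftMatY_diagonal [DecidableEq X] (h : X → ℝ) (w : X → ℝ) :
    cutCommR h h (liftMatY 𝔸 (Matrix.diagonal w)) = 0 := by
  rw [cutCommR_liftMatY]
  refine LinearMap.ext fun Λ => funext fun y => ?_
  rw [liftMatY_apply, LinearMap.zero_apply, Pi.zero_apply]
  refine Finset.sum_eq_zero fun x _ => ?_
  by_cases hxy : y = x
  · subst hxy; simp
  · rw [Matrix.of_apply, Matrix.diagonal_apply_ne _ hxy, zero_mul, Complex.ofReal_zero, zero_smul]


omit [CompleteSpace 𝔸] in
/-- **SIZE OF A TRANSPORTED LIFT AT BI-CONTRACTION TRANSPORTERS**: `‖(M♯_TΛ)(y)‖ ≤ Σ_x |M(y,x)|·‖Λ(x)‖` («u(x) ∈ G ⊂ U(N)»: `‖R(T)a‖ ≤ ‖a‖`).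
[cite: Balaban1985BackgroundPropagators, (3.28) p.395, (3.100) p.413, bookkeeping] -/
theorem norm_trLiftY_apply_le [Fintype Y] (M : Matrix Y X ℝ) {T : Y → X → 𝔸ˣ}
    (hT : ∀ y x, ‖(T y x : 𝔸)‖ ≤ 1 ∧ ‖(((T y x)⁻¹ : 𝔸ˣ) : 𝔸)‖ ≤ 1) (Λ : X → 𝔸) (y : Y) :
    ‖trLiftY M T Λ y‖ ≤ ∑ x, |M y x| * ‖Λ x‖ := by
  rw [trLiftY_apply]
  refine (norm_sum_le _ _).trans (Finset.sum_le_sum fun x _ => ?_)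
  rw [norm_smul, Complex.norm_real, Real.norm_eq_abs]
  exact mul_le_mul_of_nonneg_left (B9Eq310Hermitian.norm_R_le (hT y x).1 (hT y x).2 _) (abs_nonneg _)

omit [CompleteSpace 𝔸] in
/-- ★ **SIZE OF A CUT-OFF COMMUTATOR**: `‖([h]M♯_T Λ)(y)‖ ≤ Σ_x |M(y,x)|·|h_Y(y) − h_X(x)|·‖Λ(x)‖` — print's «coefficients determined by derivatives of
the function h», read entrywise. [cite: Balaban1985BackgroundPropagators, (3.100) p.413, p.414 («of the order O(M⁻¹), or O(M⁻²)»)] -/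
theorem norm_cutCommR_trLiftY_apply_le [Fintype Y] (hY : Y → ℝ) (hX : X → ℝ) (M : Matrix Y X ℝ) {T : Y → X → 𝔸ˣ}
    (hT : ∀ y x, ‖(T y x : 𝔸)‖ ≤ 1 ∧ ‖(((T y x)⁻¹ : 𝔸ˣ) : 𝔸)‖ ≤ 1) (Λ : X → 𝔸) (y : Y) :
    ‖cutCommR hY hX (trLiftY M T) Λ y‖ ≤ ∑ x, |M y x| * |hY y - hX x| * ‖Λ x‖ := by
  rw [cutCommR_trLiftY]
  refine (norm_trLiftY_apply_le _ hT Λ y).trans (le_of_eq (Finset.sum_congr rfl fun x _ => ?_))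
  rw [Matrix.of_apply, abs_mul]

omit [CompleteSpace 𝔸] in
/-- ★ the same against a PROFILE INCREMENT BOUND on the kernel's support and a sup bound of the argument there:
`‖([h]M♯_T Λ)(y)‖ ≤ θ·B·Σ_x |M(y,x)|`. [cite: Balaban1985BackgroundPropagators, p.414 («of the order O(M⁻¹)»), bookkeeping] -/
theorem norm_cutCommR_trLiftY_apply_le_of_bound [Fintype Y] (hY : Y → ℝ) (hX : X → ℝ) (M : Matrix Y X ℝ) {T : Y → X → 𝔸ˣ}
    (hT : ∀ y x, ‖(T y x : 𝔸)‖ ≤ 1 ∧ ‖(((T y x)⁻¹ : 𝔸ˣ) : 𝔸)‖ ≤ 1) (Λ : X → 𝔸) (y : Y) {θ B : ℝ} (hθ : 0 ≤ θ)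
    (hh : ∀ x, M y x ≠ 0 → |hY y - hX x| ≤ θ) (hΛ : ∀ x, M y x ≠ 0 → ‖Λ x‖ ≤ B) :
    ‖cutCommR hY hX (trLiftY M T) Λ y‖ ≤ θ * B * ∑ x, |M y x| := by
  refine (norm_cutCommR_trLiftY_apply_le hY hX M hT Λ y).trans ?_
  rw [Finset.mul_sum]
  refine Finset.sum_le_sum fun x _ => ?_
  by_cases hM : M y x = 0
  · rw [hM, abs_zero, zero_mul, zero_mul, mul_zero]
  · calc |M y x| * |hY y - hX x| * ‖Λ x‖ ≤ |M y x| * θ * B :=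
          mul_le_mul (mul_le_mul_of_nonneg_left (hh x hM) (abs_nonneg _)) (hΛ x hM) (norm_nonneg _)
            (mul_nonneg (abs_nonneg _) hθ)
      _ = θ * B * |M y x| := by ring

end Generic

/-! ## §2 At def-Y's covariant letters: base-point profiles and the letter commutators -/

section Letters

variable {d ℓ : ℕ} {hd : 1 ≤ d + 1} {hL : Odd (ℓ + 1) ∧ 1 < ℓ + 1} {b₀ b₁ : ℝ}
variable (i : KIdx d ℓ hd hL b₀ b₁)

/-- a site profile read on BONDS at the initial point: `h(b) := h(chart b₋)` (print's `h(x)` for `b = ⟨x, x+ηe_μ⟩`, (3.100)).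
[cite: Balaban1985BackgroundPropagators, (3.100) p.413] -/
def hBdY (h : SiteY i → ℝ) : FBondY i → ℝ := fun b => h (chartY i b.src)

/-- a site profile read on PLAQUETTES at the base point `p₋`. [cite: Balaban1985BackgroundPropagators, (3.4) p.391, (3.100) p.413, dictionary] -/
def hPlY (h : SiteY i → ℝ) : PlaqY i → ℝ := fun p => h (chartY i p.src)

/-- a site profile read on BLOCKS at def-Y's block corner (the transport base of `Q′(U)`). [cite: Balaban1985BackgroundPropagators, (3.21) p.394, (3.102) p.414, dictionary] -/
def hBkY (h : SiteY i → ℝ) : BlkY i → ℝ := fun s => h (blkCornerY i s)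

/-- a site profile read on COARSE BONDS at the corner of the CARRIER BLOCK `β(c) ∈ 𝔅` (the tree's reading of print's `c₋ ∈ Λ_j`, (3.102) «h(c₋)»;
`β` = `B6Ineq2142KLevelV1.β`, the block all bond-sector readings of the lineage are indexed by). [cite: Balaban1985BackgroundPropagators, (3.102) p.414; Balaban1984PropagatorsII, (2.45) p.231] -/
def hIbY (h : SiteY i → ℝ) : IBondY i → ℝ := fun c => hBkY i h (β i.hN i.D i.hk c)

/-- `hBdY`, evaluated. [cite: Balaban1985BackgroundPropagators, (3.100) p.413, bookkeeping] -/
theorem hBdY_apply (h : SiteY i → ℝ) (b : FBondY i) : hBdY i h b = h (chartY i b.src) := rfl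

/-- `hIbY`, evaluated. [cite: Balaban1985BackgroundPropagators, (3.102) p.414, bookkeeping] -/
theorem hIbY_apply (h : SiteY i → ℝ) (c : IBondY i) : hIbY i h c = h (blkCornerY i (β i.hN i.D i.hk c)) := rfl

/-- `hBkY`, evaluated. [cite: Balaban1985BackgroundPropagators, (3.21) p.394, bookkeeping] -/
theorem hBkY_apply (h : SiteY i → ℝ) (s : BlkY i) : hBkY i h s = h (blkCornerY i s) := rfl

/-- `hPlY`, evaluated. [cite: Balaban1985BackgroundPropagators, (3.4) p.391, bookkeeping] -/
theorem hPlY_apply (h : SiteY i → ℝ) (p : PlaqY i) : hPlY i h p = h (chartY i p.src) := rfl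

/-- ★ **(3.100) FOR `D_U : sites → bonds`**: `[h]D_U = (∂(b,z)(h(b₋) − h(z)))♯_{gradT}` — supported on `z = chart b₊`, where it is `c_f(h(b₋) − h(b₊))`,
print's `(∂_μh)(x)R(U(x, x+ηe_μ))`. [cite: Balaban1985BackgroundPropagators, (3.100) p.413] -/
theorem cutCommR_gradY (h : SiteY i → ℝ) (U : CfgY 𝔸 i) :
    cutCommR (hBdY i h) h (gradY i U) = trLiftY (Matrix.of fun b z => gradK i b z * (hBdY i h b - h z)) (gradT i U) :=
  cutCommR_trLiftY _ _ _ _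

/-- ★ (3.100) «similarly for adjoint derivatives»: `[h]D*_U` is the transported lift of `∂*(z,b)(h(z) − h(b₋))` along the inverted transporters.
[cite: Balaban1985BackgroundPropagators, (3.100) p.413, (3.8) p.392] -/
theorem cutCommR_divY (h : SiteY i → ℝ) (U : CfgY 𝔸 i) :
    cutCommR h (hBdY i h) (divY i U) = trLiftY (Matrix.of fun z b => divK i z b * (h z - hBdY i h b)) (fun z b => (gradT i U b z)⁻¹) :=
  cutCommR_trLiftY _ _ _ _

/-- (3.100) for the covariant CURL `bonds → plaquettes` (3.4). [cite: Balaban1985BackgroundPropagators, (3.4) p.391, (3.100) p.413] -/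
theorem cutCommR_curlY (h : SiteY i → ℝ) (U : CfgY 𝔸 i) :
    cutCommR (hPlY i h) (hBdY i h) (curlY i U) = trLiftY (Matrix.of fun p b => curlK i p b * (hPlY i h p - hBdY i h b)) (curlT i U) :=
  cutCommR_trLiftY _ _ _ _

/-- (3.100) for the covariant CO-CURL `plaquettes → bonds` (3.9). [cite: Balaban1985BackgroundPropagators, (3.9) p.392, (3.100) p.413] -/
theorem cutCommR_coCurlY (h : SiteY i → ℝ) (U : CfgY 𝔸 i) :
    cutCommR (hBdY i h) (hPlY i h) (coCurlY i U)
      = trLiftY (Matrix.of fun b p => cocurlK i b p * (hBdY i h b - hPlY i h p)) (fun b p => (curlT i U p b)⁻¹) :=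
  cutCommR_trLiftY _ _ _ _

/-- ★ **(3.102) FOR `Q(U) : bonds → coarse bonds`**: `[h]Q = S(∂h)` with kernel `Q(c,b)(h(c₋) − h(b₋))` («(Q_j hA)(c) = h(c₋)(Q_jA)(c) + (S_j(∂h)A)(c)»,
print's `S_j(∂h) = −[h]Q`). [cite: Balaban1985BackgroundPropagators, (3.102) p.414] -/
theorem cutCommR_QY (h : SiteY i → ℝ) (parB : BondParY 𝔸 i) (U : CfgY 𝔸 i) :
    cutCommR (hIbY i h) (hBdY i h) (QY i parB U) = trLiftY (Matrix.of fun c b => qK i c b * (hIbY i h c - hBdY i h b)) (qT i parB U) :=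
  cutCommR_trLiftY _ _ _ _

/-- (3.102) for `Q*(U) : coarse bonds → bonds` (print's `S*(∂h)`). [cite: Balaban1985BackgroundPropagators, (3.103) p.414] -/
theorem cutCommR_QsY (h : SiteY i → ℝ) (parB : BondParY 𝔸 i) (U : CfgY 𝔸 i) :
    cutCommR (hBdY i h) (hIbY i h) (QsY i parB U)
      = trLiftY (Matrix.of fun b c => qsK i b c * (hBdY i h b - hIbY i h c)) (fun b c => (qT i parB U c b)⁻¹) :=
  cutCommR_trLiftY _ _ _ _

/-- (3.102)'s site-sector twin for `Q′(U) : sites → blocks` (3.21). [cite: Balaban1985BackgroundPropagators, (3.21) p.394, (3.102) p.414] -/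
theorem cutCommR_QpY (h : SiteY i → ℝ) (parS : SiteParY 𝔸 i) (U : CfgY 𝔸 i) :
    cutCommR (hBkY i h) h (QpY i parS U) = trLiftY (Matrix.of fun s z => qpK i s z * (hBkY i h s - h z)) (qpT i parS U) :=
  cutCommR_trLiftY _ _ _ _

/-- and for `Q′*(U) : blocks → sites`. [cite: Balaban1985BackgroundPropagators, (3.24)–(3.25) p.395, (3.102) p.414] -/
theorem cutCommR_QpsY (h : SiteY i → ℝ) (parS : SiteParY 𝔸 i) (U : CfgY 𝔸 i) :
    cutCommR h (hBkY i h) (QpsY i parS U)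
      = trLiftY (Matrix.of fun z s => qpsK i z s * (h z - hBkY i h s)) (fun z s => (qpT i parS U s z)⁻¹) :=
  cutCommR_trLiftY _ _ _ _

omit [CompleteSpace 𝔸] in
/-- the weight letter `a` commutes with cut-offs (no `[a, h]` term in (3.103)). [cite: Balaban1985BackgroundPropagators, (3.103) p.414] -/
theorem cutCommR_aY (h : IBondY i → ℝ) : cutCommR h h (aY (𝔸 := 𝔸) i) = 0 := by
  classical
  show cutCommR h h (liftMatY 𝔸 (aK i)) = 0
  rw [aK_eq_diagonal]
  exact cutCommR_liftMatY_diagonal h i.w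

/-- the plaquette-wise Jordan insertion `𝒦_U` commutes with cut-offs read on plaquettes (it is fibrewise).
[cite: Balaban1985BackgroundPropagators, (3.10) p.392, p.414 («[Δ′, h]»), bookkeeping] -/
theorem cutCommR_jordanY (h : PlaqY i → ℝ) (U : CfgY 𝔸 i) : cutCommR h h (jordanY i U) = 0 := by
  refine LinearMap.ext fun F => funext fun p => ?_
  rw [cutCommR_apply, LinearMap.zero_apply, Pi.zero_apply, sub_eq_zero]
  simp only [jordanY, LinearMap.smul_apply, LinearMap.pi_apply, LinearMap.comp_apply, LinearMap.proj_apply, LinearMap.add_apply,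
    LinearMap.mulRight_apply, LinearMap.mulLeft_apply, cutMulY_apply, Pi.smul_apply]
  rw [smul_comm, smul_add, smul_mul_assoc, mul_smul_comm]

/-- ★ **(3.103)**: `[h](Q*aQ) = ([h]Q*)∘a∘Q + Q*∘a∘([h]Q)` («(Q*aQhA)(b) = h(b₋)(Q*aQA)(b) − (S*(∂h)aQA)(b) + (Q*aS(∂h)A)(b)» — two terms, `[a, h] = 0`).
[cite: Balaban1985BackgroundPropagators, (3.103) p.414] -/
theorem cutCommR_QsY_aY_QY (h : SiteY i → ℝ) (parB : BondParY 𝔸 i) (U : CfgY 𝔸 i) :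
    cutCommR (hBdY i h) (hBdY i h) (QsY i parB U ∘ₗ aY i ∘ₗ QY i parB U)
      = cutCommR (hBdY i h) (hIbY i h) (QsY i parB U) ∘ₗ aY i ∘ₗ QY i parB U
        + QsY i parB U ∘ₗ aY i ∘ₗ cutCommR (hIbY i h) (hBdY i h) (QY i parB U) := by
  rw [cutCommR_comp (hBdY i h) (hIbY i h) (hBdY i h), cutCommR_comp (hIbY i h) (hIbY i h) (hBdY i h), cutCommR_aY,
    LinearMap.zero_comp, zero_add]

/-- **`[D R D*, h]`-bookkeeping**: `[h](D∘D*) = ([h]D)∘D* + D∘([h]D*)` — «[DD*, h] … first order». [cite: Balaban1985BackgroundPropagators, p.414] -/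
theorem cutCommR_gradY_divY (h : SiteY i → ℝ) (U : CfgY 𝔸 i) :
    cutCommR (hBdY i h) (hBdY i h) (gradY i U ∘ₗ divY i U)
      = cutCommR (hBdY i h) h (gradY i U) ∘ₗ divY i U + gradY i U ∘ₗ cutCommR h (hBdY i h) (divY i U) :=
  cutCommR_comp _ _ _ _ _

/-- **`[D*𝒦D, h]`-bookkeeping**: `[h](D*∘𝒦∘D) = ([h]D*)∘𝒦∘D + D*∘𝒦∘([h]D)` («[D*D, h] … first order»; `[𝒦, h] = 0`).
[cite: Balaban1985BackgroundPropagators, p.414, (3.10) p.392] -/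
theorem cutCommR_coCurl_jordan_curl (h : SiteY i → ℝ) (U : CfgY 𝔸 i) :
    cutCommR (hBdY i h) (hBdY i h) (coCurlY i U ∘ₗ jordanY i U ∘ₗ curlY i U)
      = cutCommR (hBdY i h) (hPlY i h) (coCurlY i U) ∘ₗ jordanY i U ∘ₗ curlY i U
        + coCurlY i U ∘ₗ jordanY i U ∘ₗ cutCommR (hPlY i h) (hBdY i h) (curlY i U) := by
  rw [cutCommR_comp (hBdY i h) (hPlY i h) (hBdY i h), cutCommR_comp (hPlY i h) (hPlY i h) (hBdY i h), cutCommR_jordanY,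
    LinearMap.zero_comp, zero_add]

end Letters

/-! ## §3 (3.100) pointwise for the function-style letters `cdB`, `cdsB` -/

section Pointwise

variable {d ℓ : ℕ} {hd : 1 ≤ d + 1} {hL : Odd (ℓ + 1) ∧ 1 < ℓ + 1} {b₀ b₁ : ℝ}
variable (i : KIdx d ℓ hd hL b₀ b₁)

/-- ★ **(3.100) VERBATIM for `∇_{U,μ}` on bond functions**: `(∇_{U,μ}(hA))(b) = h(b₋)(∇_{U,μ}A)(b) + c_f(h(b₋+e_μ) − h(b₋))•R(U_μ(b₋))A(⟨b₋+e_μ, ν⟩)`.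
[cite: Balaban1985BackgroundPropagators, (3.100) p.413] -/
theorem cdB_cutMulY_apply (U : CfgY 𝔸 i) (μ : Fin (d + 1)) (h : SiteY i → ℝ) (A : FBondY i → 𝔸) (b : FBondY i) :
    cdB i U μ (cutMulY (hBdY i h) A) b
      = ((hBdY i h b : ℝ) : ℂ) • cdB i U μ A b
        + ((i.cf * (h (chartY i (b.src.shift μ)) - h (chartY i b.src)) : ℝ) : ℂ) • R (U μ b.src) (A ⟨b.src.shift μ, b.dir⟩) := by
  have e1 : (shiftsV1 (PV d ℓ i.m i.K hd hL) μ) b.src = b.src.shift μ := rfl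
  simp only [cdB, B9Eq39Adjoint.covD, e1, cutMulY_apply, hBdY_apply, R_smul, smul_sub, smul_smul]
  rw [Complex.ofReal_mul, Complex.ofReal_sub]
  module

/-- ★ (3.100) «similarly for adjoint derivatives»: `(∇*_{U,μ}(hA))(b) = h(b₋)(∇*_{U,μ}A)(b) + c_f(h(b₋−e_μ) − h(b₋))•R(U_μ(b₋−e_μ))⁻¹A(⟨b₋−e_μ, ν⟩)`.
[cite: Balaban1985BackgroundPropagators, (3.100) p.413, (3.8) p.392] -/
theorem cdsB_cutMulY_apply (U : CfgY 𝔸 i) (μ : Fin (d + 1)) (h : SiteY i → ℝ) (A : FBondY i → 𝔸) (b : FBondY i) :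
    cdsB i U μ (cutMulY (hBdY i h) A) b
      = ((hBdY i h b : ℝ) : ℂ) • cdsB i U μ A b
        + ((i.cf * (h (chartY i (b.src.unshift μ)) - h (chartY i b.src)) : ℝ) : ℂ) • R (U μ (b.src.unshift μ))⁻¹ (A ⟨b.src.unshift μ, b.dir⟩) := by
  have e1 : (shiftsV1 (PV d ℓ i.m i.K hd hL) μ).symm b.src = b.src.unshift μ := rfl
  simp only [cdsB, B9Eq39Adjoint.covDstar, e1, cutMulY_apply, hBdY_apply, R_smul, smul_sub, smul_smul]
  rw [Complex.ofReal_mul, Complex.ofReal_sub]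
  module

end Pointwise

/-! ## §4 `K(h)` for the local part of `Δ_a(U)`, `P₁(∂h)`, and (3.104) -/

section Kh

variable {d ℓ : ℕ} {hd : 1 ≤ d + 1} {hL : Odd (ℓ + 1) ∧ 1 < ℓ + 1} {b₀ b₁ : ℝ}
variable (i : KIdx d ℓ hd hL b₀ b₁)

/-- **THE LOCAL PART OF `Δ_a(U)`**: `Δ_loc(U) := Δ(U) + D_U D*_U + Q*(U)aQ(U)` («DRD* = DD* − DPD*. The operator DD* was considered above»).
[cite: Balaban1985BackgroundPropagators, (3.26) p.395, p.414] -/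
def deltaLocY (parB : BondParY 𝔸 i) (U : CfgY 𝔸 i) : (FBondY i → 𝔸) →ₗ[ℂ] (FBondY i → 𝔸) :=
  hessY i U + gradY i U ∘ₗ divY i U + QsY i parB U ∘ₗ aY i ∘ₗ QY i parB U

/-- **THE NONLOCAL PART `D_U P(U) D*_U`**, `P = 1 − R = G′Q′*(Q′G′²Q′*)⁻¹Q′G′` («DPD* has a regular kernel satisfying (3.49)»).
[cite: Balaban1985BackgroundPropagators, (3.25) p.395, (3.101) p.414] -/
def DPDsY (parS : SiteParY 𝔸 i) (Gp : SiteOpY 𝔸 i) (U : CfgY 𝔸 i) : (FBondY i → 𝔸) →ₗ[ℂ] (FBondY i → 𝔸) :=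
  gradY i U ∘ₗ (LinearMap.id - RY i parS Gp U) ∘ₗ divY i U

/-- ★ `Δ_a(U) = Δ_loc(U) − D_U P(U) D*_U` («DRD* = DD* − DPD*»). [cite: Balaban1985BackgroundPropagators, (3.26) p.395, p.414] -/
theorem deltaAY_eq_loc_sub (parS : SiteParY 𝔸 i) (parB : BondParY 𝔸 i) (Gp : SiteOpY 𝔸 i) (U : CfgY 𝔸 i) :
    deltaAY i parS parB Gp U = deltaLocY i parB U - DPDsY i parS Gp U := by
  simp only [deltaAY, deltaLocY, DPDsY, LinearMap.comp_sub, LinearMap.sub_comp, LinearMap.id_comp]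
  abel

/-- ★ **`K(h)(U)` OF (3.104)**: the cut-off commutator of the LOCAL part, `K(h) := h·Δ_loc − Δ_loc·h` («a sum of a first order differential operator and
the last two terms on the right-hand side of (3.103)»; the `[Δ′, h]` piece rides inside through `hessY = D*𝒦D + Δ′₂`). [cite: Balaban1985BackgroundPropagators, (3.104) p.414] -/
def KhBY (h : SiteY i → ℝ) (parB : BondParY 𝔸 i) (U : CfgY 𝔸 i) : (FBondY i → 𝔸) →ₗ[ℂ] (FBondY i → 𝔸) :=
  cutCommR (hBdY i h) (hBdY i h) (deltaLocY i parB U)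

/-- ★ **`P₁(∂h)(U)` OF (3.101)**: `DPD*·h − h·DPD*` («(DPD*hA)_μ(x) = h(x)(DPD*A)_μ(x) + (P₁(∂h)A)_μ(x)»).
[cite: Balaban1985BackgroundPropagators, (3.101) p.414] -/
def P1Y (h : SiteY i → ℝ) (parS : SiteParY 𝔸 i) (Gp : SiteOpY 𝔸 i) (U : CfgY 𝔸 i) : (FBondY i → 𝔸) →ₗ[ℂ] (FBondY i → 𝔸) :=
  -cutCommR (hBdY i h) (hBdY i h) (DPDsY i parS Gp U)

/-- (3.101) as an operator identity: `DPD* ∘ (h·) = (h·) ∘ DPD* + P₁(∂h)`. [cite: Balaban1985BackgroundPropagators, (3.101) p.414] -/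
theorem DPDsY_comp_cutMulY (h : SiteY i → ℝ) (parS : SiteParY 𝔸 i) (Gp : SiteOpY 𝔸 i) (U : CfgY 𝔸 i) :
    DPDsY i parS Gp U ∘ₗ cutMulY (hBdY i h) = cutMulY (hBdY i h) ∘ₗ DPDsY i parS Gp U + P1Y i h parS Gp U := by
  rw [P1Y, comp_cutMulY_eq_sub (hBdY i h) (hBdY i h), sub_eq_add_neg]

/-- ★★ **(3.104)**: `Δ_a(U) ∘ (h·) = (h·) ∘ Δ_a(U) − K(h)(U) − P₁(∂h)(U)` («Δ_a hA = hΔ_a A − K(h)A − P₁(∂h)A»).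
[cite: Balaban1985BackgroundPropagators, (3.104) p.414] -/
theorem deltaAY_comp_cutMulY (h : SiteY i → ℝ) (parS : SiteParY 𝔸 i) (parB : BondParY 𝔸 i) (Gp : SiteOpY 𝔸 i) (U : CfgY 𝔸 i) :
    deltaAY i parS parB Gp U ∘ₗ cutMulY (hBdY i h)
      = cutMulY (hBdY i h) ∘ₗ deltaAY i parS parB Gp U - KhBY i h parB U - P1Y i h parS Gp U := by
  rw [deltaAY_eq_loc_sub, LinearMap.sub_comp, comp_cutMulY_eq_sub (hBdY i h) (hBdY i h) (deltaLocY i parB U), DPDsY_comp_cutMulY,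
    KhBY, LinearMap.comp_sub]
  abel

/-- ★ **`K(h)` DECOMPOSED as print lists it**: the Hessian part `[h](D*𝒦D) + [h]Δ′₂`, the `DD*` part `([h]D)D* + D([h]D*)`, and the two (3.103) terms.
[cite: Balaban1985BackgroundPropagators, (3.104) p.414, (3.103), (3.10) p.392] -/
theorem KhBY_eq_sum (h : SiteY i → ℝ) (parB : BondParY 𝔸 i) (U : CfgY 𝔸 i) :
    KhBY i h parB U
      = (cutCommR (hBdY i h) (hPlY i h) (coCurlY i U) ∘ₗ jordanY i U ∘ₗ curlY i U
          + coCurlY i U ∘ₗ jordanY i U ∘ₗ cutCommR (hPlY i h) (hBdY i h) (curlY i U)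
          + cutCommR (hBdY i h) (hBdY i h) (curv2Y i U))
        + (cutCommR (hBdY i h) h (gradY i U) ∘ₗ divY i U + gradY i U ∘ₗ cutCommR h (hBdY i h) (divY i U))
        + (cutCommR (hBdY i h) (hIbY i h) (QsY i parB U) ∘ₗ aY i ∘ₗ QY i parB U
          + QsY i parB U ∘ₗ aY i ∘ₗ cutCommR (hIbY i h) (hBdY i h) (QY i parB U)) := by
  rw [KhBY, deltaLocY, cutCommR_add, cutCommR_add, hessY, cutCommR_add, cutCommR_coCurl_jordan_curl, cutCommR_gradY_divY,
    cutCommR_QsY_aY_QY]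

/-- ★ **THE (3.105)-TYPE SUM, ALGEBRAIC CORE**: for any family of cube letters `G_□(U)` and cut-offs `h_□` (read on bonds),
`Δ_a · Σ_□ h_□G_□h_□ = Σ_□ h_□Δ_aG_□h_□ − Σ_□ (K(h_□) + P₁(∂h_□)) G_□h_□` — the identity into which the consumer inserts the local-inverse property of its
`G_□` to reach «Δ_aG₀ = I − R» (3.105). [cite: Balaban1985BackgroundPropagators, (3.105) p.414] -/
theorem deltaAY_comp_sum (parS : SiteParY 𝔸 i) (parB : BondParY 𝔸 i) (Gp : SiteOpY 𝔸 i) (U : CfgY 𝔸 i) {κ : Type} (s : Finset κ)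
    (hf : κ → SiteY i → ℝ) (Gl : κ → (FBondY i → 𝔸) →ₗ[ℂ] (FBondY i → 𝔸)) :
    deltaAY i parS parB Gp U ∘ₗ (∑ k ∈ s, cutMulY (hBdY i (hf k)) ∘ₗ Gl k ∘ₗ cutMulY (hBdY i (hf k)))
      = (∑ k ∈ s, cutMulY (hBdY i (hf k)) ∘ₗ deltaAY i parS parB Gp U ∘ₗ Gl k ∘ₗ cutMulY (hBdY i (hf k)))
        - ∑ k ∈ s, (KhBY i (hf k) parB U + P1Y i (hf k) parS Gp U) ∘ₗ Gl k ∘ₗ cutMulY (hBdY i (hf k)) := by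
  refine LinearMap.ext fun Λ => ?_
  have hk : ∀ (k : κ) (v : FBondY i → 𝔸), deltaAY i parS parB Gp U (cutMulY (hBdY i (hf k)) v)
      = cutMulY (hBdY i (hf k)) (deltaAY i parS parB Gp U v) - KhBY i (hf k) parB U v - P1Y i (hf k) parS Gp U v := fun k v => by
    have e := LinearMap.congr_fun (deltaAY_comp_cutMulY i (hf k) parS parB Gp U) v
    simpa only [LinearMap.comp_apply, LinearMap.sub_apply] using e
  simp only [LinearMap.comp_apply, LinearMap.sum_apply, LinearMap.sub_apply, LinearMap.add_apply, map_sum, hk]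
  rw [← Finset.sum_sub_distrib]
  refine Finset.sum_congr rfl fun k _ => ?_
  abel

end Kh

end Literature.MathematicalPhysics.QuantumFieldTheory.Balaban1983to89.B9Eq3104CutoffCommutators

end
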